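import Literature.Combinatorics.Sahi2008.GeneratingFunction
import HarnessLib

/-!
# Sahi's `E_n` of a product of two INDEPENDENT families: the independent product formula

Support file for the Sahi programme (`--supports stmt-CriticalPhenomena-4575`, prover prim-sahi-p2 gen 9).
No named facts, no sorries; standard axioms.  Memo `run/shared/lean/prim/prim-sahi/prim-sahi-p2/PROOF-E3.md` §20.

**Theorem (independent product formula).**  Let `μ`, `ν` be probability weights on finite types `α`, `β`,
and `φ_i : α → ℝ`, `ψ_i : β → ℝ` (`i ∈ κ`) two families.  For the product family `F_i(x,y) = φ_i(x) ψ_i(y)`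
under the product weight `μ ⊗ ν`,

  `E_n(F_1,…,F_n) = Σ_{π ⊢ [n]} ( ∏_{B ∈ π} E_{|B|}(ψ_i : i ∈ B) ) · E_{|π|}( ∏_{i∈B} φ_i : B ∈ π )`,

the sum over the set partitions `π` of the index set (`sahiEOn_prodWeight_mul`; set partitions are the
tree's `blockFamilies`, `E` of a finset-indexed family is the tree's `sahiEOn`).  Single-space form
(`sahiE_mul_of_indepMoments`): the same identity for `F_i = Φ_i Ψ_i` on ONE probability space whenever
`E[Φ_S Ψ_S] = E[Φ_S] E[Ψ_S]` for every `S` (`Φ_S = ∏_{i∈S} Φ_i`) — e.g. events determined by disjoint sets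
of coordinates of a product measure.  Consequence (`sahiE_mul_nonneg_of_indepMoments`): if every family
drawn from the `Ψ_i` and every family of PRODUCTS of the `Φ_i` over blocks has nonnegative `E_m`, then
`E_n(Φ_1Ψ_1,…,Φ_nΨ_n) ≥ 0` — Sahi positivity of product-closed classes is preserved by independent
products (order `2`: `Cov(φ₁ψ₁, φ₂ψ₂) = Cov(ψ)E[φ₁φ₂] + E ψ₁ E ψ₂ Cov(φ)`).  Special cases in the tree:
one independent slot [`IndependentSplitting.lean`], all slots constant [Sahi2008, Thm. 6].

**Proof.**  Sahi's Proposition 12 [Sahi2008, Prop. 12 (p. 219)] in the tree's polarised forms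
(`coeff_one_sub_prod_binomB_lin`, `coeff_one_sub_prod_binomB_genB`, file `Sahi2008/GeneratingFunction.lean`):
in the square-free algebra, `1 − Σ_T E_T t^T = ∏_{(x,y)} (1 − Σ_i t_i φ_i(x)ψ_i(y))^{μ(x)ν(y)}`; for fixed
`x` the inner product over `y` is `(∏_y (1 − Σ_i (t_iφ_i(x)) ψ_i(y))^{ν(y)})^{μ(x)}` (exponent laws of the
binomial series, `binomB_one_sub_binomB`, `binomB_mul_binomB` of `Sahi2008/CumulationCone.lean`), and by
Proposition 12 for `ν` with the scalars `φ_i(x)` pulled out by multilinearity the inner product equals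
`1 − Σ_{σ ≠ ∅} (E^ν_σ(ψ) φ_σ(x)) t^σ` — a square-free element with FUNCTION coefficients `b_σ(x) = E^ν_σ(ψ)φ_σ(x)`,
to which Proposition 12 at every monomial (`genB` form) applies for `μ`.  Private lemmas of the two
Literature files are accessed with `open private … from` (as in `Sahi2008/FKGCumulation.lean`), not duplicated.
-/

set_option autoImplicit false

open Finset

open private coeff_add coeff_sub coeff_one coeff_mul coeff_sum coeff_single isNil_single
  IsNil.add IsNil.sub IsNil.mul_left IsNil.mul_right IsNil.sum
  binomB_mul_binomB binomB_one_sub_binomB isNil_one_sub_binomB coeff_empty_binomB binomB_zero_right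
  coeff_empty_mul
  from Literature.Combinatorics.Sahi2008.CumulationCone

open private coeff_genB sahiEOn_empty from Literature.Combinatorics.Sahi2008.GeneratingFunction

noncomputable section

namespace Summit.CriticalPhenomena.PercolationContinuityZ3.Theorems

namespace SahiIndependentProducts

open Literature.Combinatorics.Sahi2008 Literature.Combinatorics.Sahi2008.SqFree

variable {α β : Type*} [Fintype α] [Fintype β]
variable {κ : Type*} [DecidableEq κ] [Fintype κ]

/-! ### Plumbing in the square-free algebra -/

omit [DecidableEq κ] [Fintype κ] in
/-- Two square-free elements with the same coefficients are equal. [folklore] -/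
private theorem sqext {a b : SqFree κ ℝ} (h : ∀ τ, a.coeff τ = b.coeff τ) : a = b := by
  cases a; cases b; congr; funext τ; exact h τ

omit [Fintype κ] in
/-- Constant term of a finite product. [folklore] -/
private theorem coeff_empty_prod {γ : Type*} (s : Finset γ) (a : γ → SqFree κ ℝ) :
    (∏ y ∈ s, a y).coeff ∅ = ∏ y ∈ s, (a y).coeff ∅ := by
  induction s using Finset.cons_induction with
  | empty => rw [prod_empty, prod_empty, coeff_one, if_pos rfl]
  | cons y s hy ih => rw [prod_cons, prod_cons, coeff_empty_mul, ih]

omit [Fintype κ] in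
/-- `1 − ∏_y (1 − w_y)` has no constant term when the `w_y` have none. [folklore] -/
private theorem isNil_one_sub_prod_one_sub {γ : Type*} (s : Finset γ) (w : γ → SqFree κ ℝ)
    (hw : ∀ y ∈ s, (w y).IsNil) : (1 - ∏ y ∈ s, (1 - w y)).IsNil := by
  unfold IsNil
  rw [coeff_sub, coeff_one, if_pos rfl, coeff_empty_prod]
  have : ∏ y ∈ s, (1 - w y).coeff ∅ = 1 := by
    refine prod_eq_one fun y hy => ?_
    have h := hw y hy
    unfold IsNil at h
    rw [coeff_sub, coeff_one, if_pos rfl, h, sub_zero]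
  rw [this, sub_self]

/-- Multiplicativity of `(1-u)^c` in the base, over a finite product:
`∏_y (1 - w_y)^c = (∏_y (1 - w_y))^c`. [folklore] -/
private theorem prod_binomB_base {γ : Type*} (s : Finset γ) (c : ℝ) (w : γ → SqFree κ ℝ)
    (hw : ∀ y ∈ s, (w y).IsNil) :
    ∏ y ∈ s, binomB c (w y) = binomB c (1 - ∏ y ∈ s, (1 - w y)) := by
  induction s using Finset.cons_induction with
  | empty => rw [prod_empty, prod_empty, sub_self, binomB_zero_right]
  | cons a s ha ih =>
    have hwa : (w a).IsNil := hw a (mem_cons_self a s)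
    have hws : ∀ y ∈ s, (w y).IsNil := fun y hy => hw y (mem_cons_of_mem hy)
    rw [prod_cons, prod_cons, ih hws, binomB_mul_binomB hwa (isNil_one_sub_prod_one_sub s w hws)]
    congr 1
    ring

/-- The exponent laws for a product weight: `∏_y (1-U_y)^{c ν(y)} = (∏_y (1-U_y)^{ν(y)})^c`. [folklore] -/
private theorem prod_binomB_mul_weight (c : ℝ) (ν : β → ℝ) (U : β → SqFree κ ℝ)
    (hU : ∀ y, (U y).IsNil) :
    ∏ y, binomB (c * ν y) (U y) = binomB c (1 - ∏ y, binomB (ν y) (U y)) := by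
  have h1 : ∀ y, binomB (c * ν y) (U y) = binomB c (1 - binomB (ν y) (U y)) :=
    fun y => (binomB_one_sub_binomB (hU y) c (ν y)).symm
  rw [prod_congr rfl fun y _ => h1 y,
    prod_binomB_base univ c (fun y => 1 - binomB (ν y) (U y))
      (fun y _ => isNil_one_sub_binomB (hU y) _)]
  congr 2
  exact prod_congr rfl fun y _ => sub_sub_cancel 1 _

/-! ### Multilinearity for finset-indexed families -/

omit [Fintype β] [DecidableEq κ] [Fintype κ] in
/-- Scalars pull out of `E_{|T|}`: `E_{|T|}(c_i b_i : i ∈ T) = (∏_{i∈T} c_i) · E_{|T|}(b_i : i ∈ T)`.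
[cite: Sahi2008, p. 211 (multilinearity of `E_n`)] -/
theorem sahiEOn_const_mul {V : Type*} (μ : α → ℝ) (T : Finset V) (c : V → ℝ) (b : V → α → ℝ) :
    sahiEOn μ T (fun i x => c i * b i x) = (∏ i ∈ T, c i) * sahiEOn μ T b := by
  rw [sahiEOn, sahiEOn]
  have h : (fun i : Fin T.card => fun x => c (T.equivFin.symm i) * b (T.equivFin.symm i) x) =
      fun i => c (T.equivFin.symm i) • b (T.equivFin.symm i) := rfl
  rw [h, sahiE_smul_family]
  congr 1
  rw [← Finset.prod_coe_sort T]
  exact Fintype.prod_equiv T.equivFin.symm _ _ (fun i => rfl)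

/-! ### The inner product over the second factor -/

omit [Fintype α] in
/-- For fixed `x`, Proposition 12 for `ν` with the scalars `φ_i(x)` pulled out:
`1 − ∏_y (1 − Σ_i t_i φ_i(x)ψ_i(y))^{ν(y)} = Σ_{σ≠∅} E^ν_σ(ψ)·φ_σ(x)·t^σ`.
[cite: Sahi2008, Prop. 12 (p. 219)] -/
private theorem one_sub_prod_binomB_eq_genB (ν : β → ℝ) (hν : ∑ y, ν y = 1) (φ : κ → α → ℝ)
    (ψ : κ → β → ℝ) (x : α) :
    1 - ∏ y, binomB (ν y) (∑ i : κ, single ({i} : Finset κ) (φ i x * ψ i y)) =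
      genB (fun σ x' => sahiEOn ν σ.1 ψ * ∏ i ∈ σ.1, φ i x') x := by
  apply sqext
  intro τ
  rw [coeff_one_sub_prod_binomB_lin ν hν (fun i y => φ i x * ψ i y) τ, coeff_genB]
  by_cases hτ : τ.Nonempty
  · rw [dif_pos hτ, sahiEOn_const_mul, mul_comm]
  · rw [dif_neg hτ, not_nonempty_iff_eq_empty.1 hτ, sahiEOn_empty]

/-! ### The independent product formula -/

/-- **Independent product formula for Sahi's functionals.**  For probability weights `μ` on `α` and `ν`
on `β` and families `φ : κ → α → ℝ`, `ψ : κ → β → ℝ`, Sahi's functional of the products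
`F_i(x,y) = φ_i(x)ψ_i(y)` under the product weight `μ ⊗ ν`, on any index set `τ`, is
`E_τ(F) = Σ_{π} (∏_{σ∈π} E^ν_σ(ψ)) · E^μ_{|π|}(φ_σ : σ ∈ π)`, `φ_σ = ∏_{i∈σ} φ_i`, the sum over the set
partitions `π` of `τ` (families of pairwise disjoint nonempty blocks with union `τ`).
[cite: Sahi2008, Prop. 12 (p. 219), eqs. (4)–(7) (p. 211)] -/
theorem sahiEOn_prodWeight_mul (μ : α → ℝ) (ν : β → ℝ) (hμ : ∑ x, μ x = 1) (hν : ∑ y, ν y = 1)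
    (φ : κ → α → ℝ) (ψ : κ → β → ℝ) (τ : Finset κ) :
    sahiEOn (fun p : α × β => μ p.1 * ν p.2) τ (fun i p => φ i p.1 * ψ i p.2) =
      ∑ T ∈ blockFamilies τ,
        (∏ σ ∈ T, sahiEOn ν σ.1 ψ) * sahiEOn μ T (fun σ x => ∏ i ∈ σ.1, φ i x) := by
  have hμν : ∑ p : α × β, μ p.1 * ν p.2 = 1 := by
    rw [Fintype.sum_prod_type, ← Finset.sum_mul_sum, hμ, hν, one_mul]
  rw [← coeff_one_sub_prod_binomB_lin (fun p : α × β => μ p.1 * ν p.2) hμν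
    (fun i p => φ i p.1 * ψ i p.2) τ, Fintype.prod_prod_type]
  have hA : ∀ x, ∏ y, binomB (μ x * ν y) (∑ i : κ, single ({i} : Finset κ) (φ i x * ψ i y)) =
      binomB (μ x) (genB (fun σ x' => sahiEOn ν σ.1 ψ * ∏ i ∈ σ.1, φ i x') x) := by
    intro x
    rw [prod_binomB_mul_weight (μ x) ν _ (fun y => IsNil.sum fun i _ =>
      isNil_single (singleton_nonempty i) _), one_sub_prod_binomB_eq_genB ν hν φ ψ x]
  simp only [hA]
  rw [coeff_one_sub_prod_binomB_genB μ hμ _ τ]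
  exact sum_congr rfl fun T _ => sahiEOn_const_mul μ T _ _

/-! ### Families indexed by `Fin n` -/

omit [Fintype β] in
/-- Transport of `E_n` along an equality of lengths (plumbing). [folklore] -/
private theorem sahiE_cast (μ : α → ℝ) {m n : ℕ} (h : m = n) (f : Fin n → α → ℝ) :
    sahiE μ m (fun i => f (Fin.cast h i)) = sahiE μ n f := by
  subst h; rfl

omit [Fintype β] in
/-- `E_n` of a `Fin n`-indexed family is `E_{|univ|}` of it. [cite: Sahi2008, eqs. (4)–(7) (p. 211)] -/
theorem sahiE_eq_sahiEOn_univ (μ : α → ℝ) {n : ℕ} (f : Fin n → α → ℝ) :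
    sahiE μ n f = sahiEOn μ (univ : Finset (Fin n)) f := by
  have hc : (univ : Finset (Fin n)).card = n := by rw [card_univ, Fintype.card_fin]
  let e : Fin (univ : Finset (Fin n)).card ≃ (univ : Finset (Fin n)) :=
    (finCongr hc).trans (Equiv.subtypeUnivEquiv mem_univ).symm
  rw [← sahiE_comp_equiv_eq_sahiEOn μ univ f e, ← sahiE_cast μ hc f]
  rfl

/-- **Independent product formula, `Fin n`-indexed form** (product weight on `α × β`).
[cite: Sahi2008, Prop. 12 (p. 219), eqs. (4)–(7) (p. 211)] -/
theorem sahiE_prodWeight_mul (μ : α → ℝ) (ν : β → ℝ) (hμ : ∑ x, μ x = 1) (hν : ∑ y, ν y = 1)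
    {n : ℕ} (φ : Fin n → α → ℝ) (ψ : Fin n → β → ℝ) :
    sahiE (fun p : α × β => μ p.1 * ν p.2) n (fun i p => φ i p.1 * ψ i p.2) =
      ∑ T ∈ blockFamilies (univ : Finset (Fin n)),
        (∏ σ ∈ T, sahiEOn ν σ.1 ψ) * sahiEOn μ T (fun σ x => ∏ i ∈ σ.1, φ i x) := by
  rw [sahiE_eq_sahiEOn_univ, sahiEOn_prodWeight_mul μ ν hμ hν φ ψ univ]

/-! ### Single-space form: factorising mixed moments -/

variable {Ω : Type*} [Fintype Ω]

omit [Fintype β] [DecidableEq κ] [Fintype κ] in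
/-- Expectation of a tensor product under a product weight (plumbing). [folklore] -/
private theorem ex_prodWeight_tensor (μ : α → ℝ) (ν : Ω → ℝ) (f : α → ℝ) (g : Ω → ℝ) :
    ex (fun p : α × Ω => μ p.1 * ν p.2) (fun p => f p.1 * g p.2) = ex μ f * ex ν g := by
  simp only [ex_def, Fintype.sum_prod_type, Finset.sum_mul_sum]
  exact sum_congr rfl fun x _ => sum_congr rfl fun y _ => by ring

/-- **Independent product formula on one probability space.**  If the mixed moments of two families
`Φ, Ψ` factor, `E[Φ_S Ψ_S] = E[Φ_S]·E[Ψ_S]` for all `S` (`Φ_S = ∏_{i∈S} Φ_i`), then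
`E_n(Φ_1Ψ_1,…,Φ_nΨ_n) = Σ_π (∏_{σ∈π} E_σ(Ψ)) · E_{|π|}(Φ_σ : σ ∈ π)` over the set partitions `π` of
`{0,…,n-1}`. [cite: Sahi2008, Prop. 12 (p. 219), eqs. (4)–(7) (p. 211)] -/
theorem sahiE_mul_of_indepMoments (P : Ω → ℝ) (hP : ∑ ω, P ω = 1) {n : ℕ} (Φ Ψ : Fin n → Ω → ℝ)
    (hind : ∀ S : Finset (Fin n),
      ex P ((∏ i ∈ S, Φ i) * ∏ i ∈ S, Ψ i) = ex P (∏ i ∈ S, Φ i) * ex P (∏ i ∈ S, Ψ i)) :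
    sahiE P n (fun i => Φ i * Ψ i) =
      ∑ T ∈ blockFamilies (univ : Finset (Fin n)),
        (∏ σ ∈ T, sahiEOn P σ.1 Ψ) * sahiEOn P T (fun σ ω => ∏ i ∈ σ.1, Φ i ω) := by
  rw [← sahiE_prodWeight_mul P P hP hP Φ Ψ]
  refine sahiE_congr_of_moments P (fun p : Ω × Ω => P p.1 * P p.2) n _ _ fun S _ => ?_
  have h1 : (∏ i ∈ S, (Φ i * Ψ i)) = (∏ i ∈ S, Φ i) * ∏ i ∈ S, Ψ i := prod_mul_distrib
  have h2 : (∏ i ∈ S, fun p : Ω × Ω => Φ i p.1 * Ψ i p.2) =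
      fun p : Ω × Ω => (∏ i ∈ S, Φ i) p.1 * (∏ i ∈ S, Ψ i) p.2 := by
    funext p
    rw [Finset.prod_apply, Finset.prod_apply, Finset.prod_apply, ← prod_mul_distrib]
  rw [h1, hind, h2, ex_prodWeight_tensor]

/-- **Sahi positivity is preserved by independent products of product-closed families.**  If every
family drawn from `Ψ_0,…,Ψ_{n-1}` has `E_m ≥ 0`, every family of block products `∏_{i∈B_j} Φ_i` has
`E_m ≥ 0`, and the mixed moments of `Φ` and `Ψ` factor, then `E_n(Φ_1Ψ_1,…,Φ_nΨ_n) ≥ 0`.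
[cite: Sahi2008, Prop. 12 (p. 219), Conj. 5 (p. 212)] -/
theorem sahiE_mul_nonneg_of_indepMoments (P : Ω → ℝ) (hP : ∑ ω, P ω = 1) {n : ℕ}
    (Φ Ψ : Fin n → Ω → ℝ)
    (hind : ∀ S : Finset (Fin n),
      ex P ((∏ i ∈ S, Φ i) * ∏ i ∈ S, Ψ i) = ex P (∏ i ∈ S, Φ i) * ex P (∏ i ∈ S, Ψ i))
    (hΨ : ∀ (m : ℕ) (ι : Fin m → Fin n), 0 ≤ sahiE P m (fun j => Ψ (ι j)))
    (hΦ : ∀ (m : ℕ) (B : Fin m → Finset (Fin n)), 0 ≤ sahiE P m (fun j => ∏ i ∈ B j, Φ i)) :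
    0 ≤ sahiE P n (fun i => Φ i * Ψ i) := by
  rw [sahiE_mul_of_indepMoments P hP Φ Ψ hind]
  refine sum_nonneg fun T _ => mul_nonneg (prod_nonneg fun σ _ => ?_) ?_
  · rw [sahiEOn]
    exact hΨ _ _
  · rw [sahiEOn]
    have h : (fun j : Fin T.card => fun ω => ∏ i ∈ (T.equivFin.symm j : NEFinset (Fin n)).1, Φ i ω) =
        fun j => ∏ i ∈ (T.equivFin.symm j : NEFinset (Fin n)).1, Φ i := by
      funext j ω; rw [Finset.prod_apply]
    rw [h]
    exact hΦ _ _

end SahiIndependentProducts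

end Summit.CriticalPhenomena.PercolationContinuityZ3.Theorems

namespace Summit.CriticalPhenomena.PercolationContinuityZ3.Theorems

namespace SahiIndependentProducts

open Finset Literature.Combinatorics.Sahi2008

variable {α β : Type*} [Fintype α] [Fintype β]

/-! ### Tensor products of multiplicatively closed Sahi-positive classes -/

/-- **Independent products preserve Sahi positivity of multiplicatively closed classes (all orders).**  Let
`𝒜` be a class of functions on `α` closed under multiplication and containing `1`, such that every finite
family from `𝒜` has `E_m ≥ 0` under `μ`; let `ℬ` be a class of functions on `β` such that every finite family
from `ℬ` has `E_m ≥ 0` under `ν` (`μ, ν` probability weights).  Then every family of products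
`φ_i(x)ψ_i(y)`, `φ_i ∈ 𝒜`, `ψ_i ∈ ℬ`, has `E_n ≥ 0` under the product weight `μ ⊗ ν`.  (Examples of such
classes in the tree: all nonnegative monotone functions on a finite chain, `sahiPositive_of_linearOrder`;
Sahi's cumulations on `2^X` under a product weight, `sahi2008_thm2` with `IsCumulation.mul`.)
[cite: Sahi2008, Prop. 12 (p. 219), Thm. 2 (p. 210), Conj. 5 (p. 212)] -/
theorem sahiE_prodWeight_nonneg_of_classes (μ : α → ℝ) (ν : β → ℝ) (hμ : ∑ x, μ x = 1)
    (hν : ∑ y, ν y = 1) (𝒜 : Set (α → ℝ)) (ℬ : Set (β → ℝ))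
    (h𝒜one : (1 : α → ℝ) ∈ 𝒜) (h𝒜mul : ∀ f ∈ 𝒜, ∀ g ∈ 𝒜, f * g ∈ 𝒜)
    (h𝒜 : ∀ (m : ℕ) (f : Fin m → α → ℝ), (∀ j, f j ∈ 𝒜) → 0 ≤ sahiE μ m f)
    (hℬ : ∀ (m : ℕ) (g : Fin m → β → ℝ), (∀ j, g j ∈ ℬ) → 0 ≤ sahiE ν m g)
    {n : ℕ} (φ : Fin n → α → ℝ) (ψ : Fin n → β → ℝ) (hφ : ∀ i, φ i ∈ 𝒜) (hψ : ∀ i, ψ i ∈ ℬ) :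
    0 ≤ sahiE (fun p : α × β => μ p.1 * ν p.2) n (fun i p => φ i p.1 * ψ i p.2) := by
  rw [sahiE_prodWeight_mul μ ν hμ hν φ ψ]
  refine sum_nonneg fun T _ => mul_nonneg (prod_nonneg fun σ _ => ?_) ?_
  · rw [sahiEOn]
    exact hℬ _ _ fun j => hψ _
  · rw [sahiEOn]
    refine h𝒜 _ _ fun j => ?_
    have key : ∀ S : Finset (Fin n), (fun x => ∏ i ∈ S, φ i x) ∈ 𝒜 := by
      intro S
      induction S using Finset.induction_on with
      | empty =>
        have : (fun x : α => ∏ i ∈ (∅ : Finset (Fin n)), φ i x) = 1 := by funext x; simp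
        rw [this]; exact h𝒜one
      | insert i S hi ih =>
        have : (fun x : α => ∏ i' ∈ insert i S, φ i' x) = φ i * fun x => ∏ i' ∈ S, φ i' x := by
          funext x; rw [Finset.prod_insert hi]; rfl
        rw [this]; exact h𝒜mul _ (hφ i) _ ih
    exact key _

/-- **Single-space form for classes.**  On one probability space: if `𝒜` (multiplicatively closed, `1 ∈ 𝒜`)
and `ℬ` are classes all of whose finite families have `E_m ≥ 0`, and the mixed moments of `Φ_i ∈ 𝒜` and
`Ψ_i ∈ ℬ` factor, then `E_n(Φ_1Ψ_1,…,Φ_nΨ_n) ≥ 0`. [cite: Sahi2008, Prop. 12 (p. 219), Conj. 5 (p. 212)] -/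
theorem sahiE_mul_nonneg_of_classes {Ω : Type*} [Fintype Ω] (P : Ω → ℝ) (hP : ∑ ω, P ω = 1)
    (𝒜 ℬ : Set (Ω → ℝ)) (h𝒜one : (1 : Ω → ℝ) ∈ 𝒜) (h𝒜mul : ∀ f ∈ 𝒜, ∀ g ∈ 𝒜, f * g ∈ 𝒜)
    (h𝒜 : ∀ (m : ℕ) (f : Fin m → Ω → ℝ), (∀ j, f j ∈ 𝒜) → 0 ≤ sahiE P m f)
    (hℬ : ∀ (m : ℕ) (g : Fin m → Ω → ℝ), (∀ j, g j ∈ ℬ) → 0 ≤ sahiE P m g)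
    {n : ℕ} (Φ Ψ : Fin n → Ω → ℝ) (hΦ : ∀ i, Φ i ∈ 𝒜) (hΨ : ∀ i, Ψ i ∈ ℬ)
    (hind : ∀ S : Finset (Fin n),
      ex P ((∏ i ∈ S, Φ i) * ∏ i ∈ S, Ψ i) = ex P (∏ i ∈ S, Φ i) * ex P (∏ i ∈ S, Ψ i)) :
    0 ≤ sahiE P n (fun i => Φ i * Ψ i) := by
  refine sahiE_mul_nonneg_of_indepMoments P hP Φ Ψ hind (fun m ι => hℬ _ _ fun j => hΨ _) fun m B => ?_
  refine h𝒜 _ _ fun j => ?_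
  have key : ∀ S : Finset (Fin n), (∏ i ∈ S, Φ i) ∈ 𝒜 := by
    intro S
    induction S using Finset.induction_on with
    | empty => rw [Finset.prod_empty]; exact h𝒜one
    | insert i S hi ih => rw [Finset.prod_insert hi]; exact h𝒜mul _ (hΦ i) _ ih
  exact key _

end SahiIndependentProducts

end Summit.CriticalPhenomena.PercolationContinuityZ3.Theorems
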